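import Summits.AtomisticToContinuum.Crystallization.Theorems.OverbindingBudgetRegistrySquare
import Summits.AtomisticToContinuum.Crystallization.Theorems.ChartedPlanarOrderStackedUniform
import Summits.AtomisticToContinuum.Crystallization.Theorems.ChartedPlanarOrderTubeConvexSplit

/-!
# OverbindingBudget · decomp-a2c lens-4 g33 — part XXI-D: the CELL NORMAL FORM of slot 7d (T/S dichotomy; R4 repaired; both branches cut)

Helper file under `--supports stmt-AtomisticToContinuum-31280` (RDEF = `Theses.OverbindingBudget.RobustDefectLimitWindows`); closes nothing.

NODE «CellNormalForm» (minimal counterexample in normal form).  Part XX's R4 `CellPinningW Λ₁ s₁ s₂` is false as typed — the zero-pressure fcc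
crystal presented on its `{100}` square layers satisfies every binder of 7d and has `‖a ± b‖ = √2·d⋆ ∉ [s₁, s₂]` (see part XXI-S's docstring) —
and lens-3's PROVED one-scale normal form `stackedUniform` says this is the ONLY other cell type: an admissible stacked configuration with
periods `≤ 17/16` is T-type (`95/289·‖a‖² ≤ |⟪a, b⟫|`, triangular layers) or S-type (`|⟪a, b⟫| ≤ 11/75·‖a‖²`, square layers).  This file

1. re-types R4 as the DICHOTOMY R4′ `CellPinningDichotomyW Λ₁ s₁ s₂ t₁ t₂` (admissible ⇒ `Pinned s₁ s₂ a b ∨ PinnedSq t₁ t₂ a b`) and cuts it,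
   seam PROVED from `stackedUniform` (`Λ₁ ≤ 17/16`; 7d's `IsCleanW` is `IsCleanP (103/100)` by `rfl`, `103/100 ≤ 8/7`), into
   R4T `CellPinningT Λ₁ s₁ s₂` (admissible ∧ T-type ⇒ `Pinned`) [ANALYTIC·M + CERT: zero in-plane virial + zero gap stress ⇒ zero-stress Barlow
   cell] and R4S `CellPinningS Λ₁ t₁ t₂` (admissible ∧ S-type ⇒ `PinnedSq`) [same, square cell: `d_sq⋆ = d⋆` of fcc to `10⁻⁴`];
2. keeps the T branch of record (R3 `RegistryLocalisationW`, Z∃ `RegistryZeroExists` ⟸ R1 ∧ R2, R5 `RegistryMetric`; their `Pinned` hypothesis is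
   exactly the T case) and cuts R3 further (critic row 469 (c)) into R3geo `RegistryGeometryW Λ₁ s₁ s₂ h₀ τ₀` (GEOMETRY: the configuration is
   within `τ₀` of the two-valued registry profile centred at the EXPLICIT point `hol a b + h₀ • n`) ∧ `BalancedLocus s₁ s₂ h₀ τ` (configuration-free
   CERT·M: a balanced increment within `τ` of that point exists over every pinned cell), seam PROVED by re-centring
   (`‖reg … c … m − reg … c′ … m‖ = ‖c − c′‖`, `τ₀ + τ ≤ r′`);
3. adds the S branch, RESIDUAL-FREE: SqR3 `SqRegistryLocalisationW Λ₁ t₁ t₂ h₁ τ rₛ` (admissible ∧ `PinnedSq` ⇒ within `rₛ` of a ONE-valued square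
   registry profile `regSq a b c u v` with `c` square-balanced of height within `τ` of `h₁`) ⟸ SqR3geo `SqRegistryGeometryW Λ₁ t₁ t₂ h₁ τ₀`
   (GEOMETRY) ∧ `SqBalancedHeight t₁ t₂ h₁ τ` (CERT·S, ONE-dimensional: a zero of the scalar normal stress `h ↦ ⟪unifStress a b (holSq a b + h n), n⟫`
   with `|h − h₁| ≤ τ`, `h ≥ 1/2` — lateral balance is automatic by XXI-S's half-turn symmetry), seam PROVED; and SqR5 `SqRegistryMetric t₁ t₂ h₁ τ r″`
   (PATTERN·S: increments within `r″` of such a profile ⇒ `UniformlyClean`; pure lattice geometry, no LJ content).  No S-analogue of Z∃/R1/R2 is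
   needed: by XXI-S's `gapStress_regSq` the square registry profile itself has ALL gap stresses `= unifStress a b c = 0`, so the reference is
   EXPLICIT (`psum (regSq a b c u v)`), stacked (heights `⟪c, n⟫ ≥ 1/2`), within `rₛ ≤ ρ₁` of the configuration;
4. PROVES the repaired ★ seam `basalReferenceW_of_dichotomy : R4′ → R3 r′ → Z∃ r″ → R5 r″ → SqR3 h₁ τ rₛ → SqR5 h₁ τ rₛ″ → (r″ < 1/2, r′ + r″ ≤ ρ₁,
   0 ≤ rₛ″, rₛ ≤ ρ₁) → BasalReferenceW Λ₁ ρ₁` and the cones: TWENTIETH `rdef_of_grossU_shape_gluing_pinning_uniq_dichotomy` (= XIX-U with 7d so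
   cut), its convex-fed twin `…_pinning_convexW'_dichotomy` (7c′ := lens-3's `TubeConvexW' Λ₁ ρ₀`, the cone of record's typing), and the LEAF-CUT
   corollary at the numbers of record `rdef_twentieth_of_recordK` (`(Λ, Λ₁; ρ₀, ρ₁; ε, r, μ; r″) = (2, 17/16; 1/40, 3/16; 1/250, 1/100, 1; 3/500)`,
   T: `(τ₀, τ) = (3/20, 1/40)` so `r′ = 7/40`; S: `(τ₀, τ, rₛ, rₛ″) = (3/20, 1/100, 4/25, 0)`; boxes `[s₁, s₂]`, `[t₁, t₂]` and central heights
   `h₀ ≈ 0.793`, `h₁ ≈ 0.687` SYMBOLIC until the census fixes them).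

Every piece is strictly weaker than 7d: R4T/R4S conclude only cell inequalities; R3geo/SqR3geo only localisation; `BalancedLocus`/`SqBalancedHeight`/
R1/R2/R5/SqR5 are configuration-free statements about explicit lattice profiles.  Numbers provisional (census TAGs requested in the g33 memo).
-/

noncomputable section

namespace Summit.AtomisticToContinuum.Crystallization.Theorems.OverbindingBudgetRegistryDichotomy

open Metric
open scoped RealInnerProductSpace
open Summit.AtomisticToContinuum.Crystallization.Theses.OverbindingBudget (RobustDefectLimitWindows)
open Summit.AtomisticToContinuum.Crystallization.Theses.PricedLinkCensus (ChargedEnergyGap)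
open Summit.AtomisticToContinuum.Crystallization.Theorems.OverbindingBudgetGradedBareness (CleanlessExcessT)
open Summit.AtomisticToContinuum.Crystallization.Theorems.OverbindingBudgetCoherentCut (CoherentResidual)
open Summit.AtomisticToContinuum.Crystallization.Theorems.OverbindingBudgetUniformCutStatements (GrossCleanBallsU)
open Summit.AtomisticToContinuum.Crystallization.Theorems.OverbindingBudgetElasticSplitScale (CompressedVirialLaw)
open Summit.AtomisticToContinuum.Crystallization.Theorems.OverbindingBudgetElasticSplitShear (StressFree)
open Summit.AtomisticToContinuum.Crystallization.Theorems.ChartedPlanarOrderChunkFloor (E3)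
open Summit.AtomisticToContinuum.Crystallization.Theorems.ChartedPlanarOrderRigidityDoor (IsNash)
open Summit.AtomisticToContinuum.Crystallization.Theorems.ChartedPlanarOrderDensityDichotomy (μS IsSep)
open Summit.AtomisticToContinuum.Crystallization.Theorems.ChartedPlanarOrderDoorLayered (Layered)
open Summit.AtomisticToContinuum.Crystallization.Theorems.ChartedPlanarOrderProfileSlavingLJ (IsStacked gapStress incr tube)
open Summit.AtomisticToContinuum.Crystallization.Theorems.ChartedPlanarOrderCleanScaleP (IsCleanP)
open Summit.AtomisticToContinuum.Crystallization.Theorems.ChartedPlanarOrderStackedUniform (stackedUniform)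
open Summit.AtomisticToContinuum.Crystallization.Theorems.ChartedPlanarOrderTubeConvex (TubeConvexW' tubeUniquenessW_of_tubeConvexW')
open Summit.AtomisticToContinuum.Crystallization.Theorems.OverbindingBudgetPeriodicCleanOrStrained (UniformlyClean)
open Summit.AtomisticToContinuum.Crystallization.Theorems.OverbindingBudgetScaleWidening (IsCleanW DoorPeriodicW)
open Summit.AtomisticToContinuum.Crystallization.Theorems.OverbindingBudgetTwoShellShape (TwoShellShape BarlowGluingW)
open Summit.AtomisticToContinuum.Crystallization.Theorems.OverbindingBudgetStackedRigidityW (StackedReductionW GapStressVanishesW BasalReferenceW)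
open Summit.AtomisticToContinuum.Crystallization.Theorems.OverbindingBudgetStackedRigidityRef (RegistryPinningW)
open Summit.AtomisticToContinuum.Crystallization.Theorems.OverbindingBudgetStackedRigidityUniq (TubeUniquenessW
  rdef_of_grossU_shape_gluing_pinning_uniqW)
open Summit.AtomisticToContinuum.Crystallization.Theorems.OverbindingBudgetRegistryCut (hol unifStress IsUnitNormal IsBalanced reg Pinned
  RegistryLocalisationW RegistryResidual RegistryTube RegistryMetric RegistryZeroExists isStacked_of_near_reg exists_profile_of_incr
  zeroExists_of_residual_tube)
open Summit.AtomisticToContinuum.Crystallization.Theorems.OverbindingBudgetRegistrySquare (holSq IsSqBalanced regSq PinnedSq norm_reg_sub_reg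
  regSq_sub_regSq isStacked_of_near_regSq inner_holSq_height lateral_holSq_height norm_height_sub gapStress_regSq isSqBalanced_of_normal)

/-! ## §1 Cell types and the repaired R4 (the dichotomy) -/

/-- T-type (near-triangular) cell: the first branch of `stackedUniform`. -/
def IsTType (a b : E3) : Prop := 95 / 289 * ‖a‖ ^ 2 ≤ |⟪a, b⟫|

/-- S-type (near-square) cell: the second branch of `stackedUniform`. -/
def IsSType (a b : E3) : Prop := |⟪a, b⟫| ≤ 11 / 75 * ‖a‖ ^ 2

/-- **R4T · `CellPinningT Λ₁ s₁ s₂`** — an admissible configuration (7d's hypotheses verbatim) with a T-type cell has a pinned near-triangular cell.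
Why it might fail: only if `[s₁, s₂]` is set tighter than the spread of the zero-stress nn distance over Barlow words (`≈ 10⁻⁴`); zero in-plane
virial and zero gap stress are equalities. [ANALYTIC·M + CERT] [piece] -/
def CellPinningT (Λ₁ s₁ s₂ : ℝ) : Prop :=
  ∀ δ : ℝ, 0 < δ → ∀ (a b : E3) (w : ℤ → E3), IsStacked a b w → LinearIndependent ℝ ![a, b] →
    ‖a‖ ≤ Λ₁ → ‖b‖ ≤ Λ₁ → IsSep δ (Layered a b w) → IsCleanW (μS (Layered a b w)) → IsNash (μS (Layered a b w)) →
    StressFree (Layered a b w) → (∀ m : ℤ, gapStress a b m (incr w) = 0) → IsTType a b → Pinned s₁ s₂ a b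

/-- **R4S · `CellPinningS Λ₁ t₁ t₂`** — an admissible configuration with an S-type cell has a pinned near-square cell.  Why it might fail: as R4T
(the zero-stress square-layer cell is the fcc `{100}` cell, side `d⋆`; box `[t₁, t₂]` from the census). [ANALYTIC·M + CERT] [piece] -/
def CellPinningS (Λ₁ t₁ t₂ : ℝ) : Prop :=
  ∀ δ : ℝ, 0 < δ → ∀ (a b : E3) (w : ℤ → E3), IsStacked a b w → LinearIndependent ℝ ![a, b] →
    ‖a‖ ≤ Λ₁ → ‖b‖ ≤ Λ₁ → IsSep δ (Layered a b w) → IsCleanW (μS (Layered a b w)) → IsNash (μS (Layered a b w)) →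
    StressFree (Layered a b w) → (∀ m : ℤ, gapStress a b m (incr w) = 0) → IsSType a b → PinnedSq t₁ t₂ a b

/-- **R4′ · `CellPinningDichotomyW Λ₁ s₁ s₂ t₁ t₂`** (the repaired R4, interface) — an admissible configuration has a pinned near-triangular OR a
pinned near-square cell.  Fed by R4T ∧ R4S (`cellPinningDichotomyW_of_TS`, PROVED for `Λ₁ ≤ 17/16`). [piece] -/
def CellPinningDichotomyW (Λ₁ s₁ s₂ t₁ t₂ : ℝ) : Prop :=
  ∀ δ : ℝ, 0 < δ → ∀ (a b : E3) (w : ℤ → E3), IsStacked a b w → LinearIndependent ℝ ![a, b] →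
    ‖a‖ ≤ Λ₁ → ‖b‖ ≤ Λ₁ → IsSep δ (Layered a b w) → IsCleanW (μS (Layered a b w)) → IsNash (μS (Layered a b w)) →
    StressFree (Layered a b w) → (∀ m : ℤ, gapStress a b m (incr w) = 0) → Pinned s₁ s₂ a b ∨ PinnedSq t₁ t₂ a b

/-! ## §2 The T branch: R3 cut into geometry and a configuration-free balanced locus -/

/-- **R3geo · `RegistryGeometryW Λ₁ s₁ s₂ h₀ τ₀`** — an admissible configuration over a pinned near-triangular cell is within `τ₀`, increment by
increment, of the two-valued registry profile centred at the EXPLICIT point `hol a b + h₀ • n`.  Why it might fail: `τ₀` below the clean-W hollow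
registration tolerance (`≈ 0.07` lateral) plus the height spread round `h₀` (`≈ 0.01` over the box); of record `(h₀, τ₀) ≈ (0.793, 3/20)`.
[GEOMETRY·S/M] [piece] -/
def RegistryGeometryW (Λ₁ s₁ s₂ h₀ τ₀ : ℝ) : Prop :=
  ∀ δ : ℝ, 0 < δ → ∀ (a b : E3) (w : ℤ → E3), IsStacked a b w → LinearIndependent ℝ ![a, b] →
    ‖a‖ ≤ Λ₁ → ‖b‖ ≤ Λ₁ → IsSep δ (Layered a b w) → IsCleanW (μS (Layered a b w)) → IsNash (μS (Layered a b w)) →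
    StressFree (Layered a b w) → (∀ m : ℤ, gapStress a b m (incr w) = 0) → Pinned s₁ s₂ a b →
    ∃ (n : E3) (σ : ℤ → Bool) (u v : ℤ → ℤ), IsUnitNormal a b n ∧ ∀ m : ℤ, ‖incr w m - reg a b n (hol a b + h₀ • n) σ u v m‖ ≤ τ₀

/-- **`BalancedLocus s₁ s₂ h₀ τ`** (configuration-free) — over every pinned near-triangular cell with unit normal `n` there is a balanced increment
within `τ` of `hol a b + h₀ • n`.  Why it might fail: `τ` below the spread of the balanced point over the box (height `≈ 0.816·d`, lateral shift
for non-equilateral cells), or no interior critical point of the uniform-stack cell energy in the `IsBalanced` cylinder; of record `τ = 1/40`.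
[CERT·M] [piece] -/
def BalancedLocus (s₁ s₂ h₀ τ : ℝ) : Prop :=
  ∀ (a b n : E3), Pinned s₁ s₂ a b → IsUnitNormal a b n → ∃ c : E3, IsBalanced a b n c ∧ ‖c - (hol a b + h₀ • n)‖ ≤ τ

/-! ## §3 The S branch (square layers): localisation to the one-valued square registry, its geometry/height cut, the metric check -/

/-- **SqR3 · `SqRegistryLocalisationW Λ₁ t₁ t₂ h₁ τ rₛ`** (interface) — an admissible configuration over a pinned near-square cell is within `rₛ`,
increment by increment, of a one-valued square registry profile with a square-balanced increment of height within `τ` of `h₁`.  Fed by SqR3geo ∧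
`SqBalancedHeight` (`sqRegistryLocalisationW_of_geometry_height`, PROVED). [piece] -/
def SqRegistryLocalisationW (Λ₁ t₁ t₂ h₁ τ rₛ : ℝ) : Prop :=
  ∀ δ : ℝ, 0 < δ → ∀ (a b : E3) (w : ℤ → E3), IsStacked a b w → LinearIndependent ℝ ![a, b] →
    ‖a‖ ≤ Λ₁ → ‖b‖ ≤ Λ₁ → IsSep δ (Layered a b w) → IsCleanW (μS (Layered a b w)) → IsNash (μS (Layered a b w)) →
    StressFree (Layered a b w) → (∀ m : ℤ, gapStress a b m (incr w) = 0) → PinnedSq t₁ t₂ a b →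
    ∃ (n c : E3) (u v : ℤ → ℤ), IsUnitNormal a b n ∧ IsSqBalanced a b n c ∧ |⟪c, n⟫ - h₁| ≤ τ ∧
      ∀ m : ℤ, ‖incr w m - regSq a b c u v m‖ ≤ rₛ

/-- **SqR3geo · `SqRegistryGeometryW Λ₁ t₁ t₂ h₁ τ₀`** — an admissible configuration over a pinned near-square cell is within `τ₀`, increment by
increment, of the square registry profile centred at the EXPLICIT point `holSq a b + h₁ • n`.  Why it might fail: `τ₀` below the clean-W
registration tolerance of square layers plus the height spread round `h₁ ≈ d/√2`; of record `(h₁, τ₀) ≈ (0.687, 3/20)`. [GEOMETRY·S/M] [piece] -/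
def SqRegistryGeometryW (Λ₁ t₁ t₂ h₁ τ₀ : ℝ) : Prop :=
  ∀ δ : ℝ, 0 < δ → ∀ (a b : E3) (w : ℤ → E3), IsStacked a b w → LinearIndependent ℝ ![a, b] →
    ‖a‖ ≤ Λ₁ → ‖b‖ ≤ Λ₁ → IsSep δ (Layered a b w) → IsCleanW (μS (Layered a b w)) → IsNash (μS (Layered a b w)) →
    StressFree (Layered a b w) → (∀ m : ℤ, gapStress a b m (incr w) = 0) → PinnedSq t₁ t₂ a b →
    ∃ (n : E3) (u v : ℤ → ℤ), IsUnitNormal a b n ∧ ∀ m : ℤ, ‖incr w m - regSq a b (holSq a b + h₁ • n) u v m‖ ≤ τ₀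

/-- **`SqBalancedHeight t₁ t₂ h₁ τ`** (configuration-free, ONE-dimensional) — over every pinned near-square cell with unit normal `n` the scalar
normal stress of the uniform square stack `h ↦ ⟪unifStress a b (holSq a b + h • n), n⟫` has a zero `h ≥ 1/2` with `|h − h₁| ≤ τ`.  Why it might
fail: `τ` below the spread of the balanced height (`≈ 0.707·d`, `≈ 0.007` over a `1 %` box) or a sign pattern without change on
`[h₁ − τ, h₁ + τ]`; of record `τ = 1/100` (SqR5's bond window forces `τ ≲ 0.012`). [CERT·S: interval signs at `h₁ ± τ` + continuity] [piece] -/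
def SqBalancedHeight (t₁ t₂ h₁ τ : ℝ) : Prop :=
  ∀ (a b n : E3), PinnedSq t₁ t₂ a b → IsUnitNormal a b n →
    ∃ h : ℝ, |h - h₁| ≤ τ ∧ 1 / 2 ≤ h ∧ ⟪unifStress a b (holSq a b + h • n), n⟫ = 0

/-- **SqR5 · `SqRegistryMetric t₁ t₂ h₁ τ r″`** — an offset profile whose increments are within `r″` of a one-valued square registry profile
(square-hollow-centred, height within `τ` of `h₁`) over a pinned near-square cell generates a UNIFORMLY CLEAN layered set.  Why it might fail: the
twelve bonds (`4` in-plane `∈ [t₁, t₂]`, `8` interlayer `√(diag²/4 + h²) ∈ [0.961, 0.981]` at `τ = 1/100` on the box `[0.966, 0.976]`) must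
lie in `[0.98 a′, 1.02 a′]` for one `a′ ∈ [47/50, 1]` (`a′ = 0.971` does it; second distances `≥ 2h ≥ 1.35 > 1.26 a′`), and `τ = 1/40` would
NOT do (`[0.951, 0.992]`); of record `(τ, r″) = (1/100, 0)`. [PATTERN·S] [piece] -/
def SqRegistryMetric (t₁ t₂ h₁ τ r'' : ℝ) : Prop :=
  ∀ (a b n c : E3) (u v : ℤ → ℤ), PinnedSq t₁ t₂ a b → IsUnitNormal a b n → c - ⟪c, n⟫ • n = holSq a b → |⟪c, n⟫ - h₁| ≤ τ →
    ∀ w' : ℤ → E3, (∀ k : ℤ, ‖incr w' k - regSq a b c u v k‖ ≤ r'') → UniformlyClean (Layered a b w')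

/-! ## §4 Seams (PROVED) -/

/-- ★ **the dichotomy seam**: `CellPinningT → CellPinningS → CellPinningDichotomyW` for `Λ₁ ≤ 17/16`, by lens-3's `stackedUniform` (7d's `IsCleanW`
is `IsCleanP (103/100)` definitionally, `103/100 ≤ 8/7`). [this file] -/
theorem cellPinningDichotomyW_of_TS {Λ₁ s₁ s₂ t₁ t₂ : ℝ} (hΛ₁ : Λ₁ ≤ 17 / 16) (hT : CellPinningT Λ₁ s₁ s₂) (hS : CellPinningS Λ₁ t₁ t₂) :
    CellPinningDichotomyW Λ₁ s₁ s₂ t₁ t₂ := by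
  intro δ hδ a b w hst hab ha hb hs hc hna hf hz
  have hc' : IsCleanP (103 / 100) (μS (Layered a b w)) := hc
  obtain ⟨ν, -, -, -, -, -, -, -, hTS⟩ :=
    stackedUniform (by norm_num : (103 / 100 : ℝ) ≤ 8 / 7) hδ hs hc' hst (ha.trans hΛ₁) (hb.trans hΛ₁)
  rcases hTS with ⟨hT', -⟩ | ⟨hS', -⟩
  · exact Or.inl (hT δ hδ a b w hst hab ha hb hs hc hna hf hz hT')
  · exact Or.inr (hS δ hδ a b w hst hab ha hb hs hc hna hf hz hS')

/-- ★ **R3 from geometry + locus**: `RegistryGeometryW h₀ τ₀ → BalancedLocus h₀ τ → RegistryLocalisationW r′` for `τ₀ + τ ≤ r′` (re-centre the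
registry profile at the balanced increment: `‖reg … c₀ … m − reg … c … m‖ = ‖c₀ − c‖ ≤ τ`). [this file] -/
theorem registryLocalisationW_of_geometry_locus {Λ₁ s₁ s₂ h₀ τ₀ τ r' : ℝ} (hτ : τ₀ + τ ≤ r') (hGeo : RegistryGeometryW Λ₁ s₁ s₂ h₀ τ₀)
    (hBal : BalancedLocus s₁ s₂ h₀ τ) : RegistryLocalisationW Λ₁ s₁ s₂ r' := by
  intro δ hδ a b w hst hab ha hb hs hc hna hf hz hp
  obtain ⟨n, σ, u, v, hn, hloc⟩ := hGeo δ hδ a b w hst hab ha hb hs hc hna hf hz hp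
  obtain ⟨c, hbal, hcc⟩ := hBal a b n hp hn
  refine ⟨n, c, σ, u, v, hn, hbal, fun m => ?_⟩
  calc ‖incr w m - reg a b n c σ u v m‖
      ≤ ‖incr w m - reg a b n (hol a b + h₀ • n) σ u v m‖ + ‖reg a b n (hol a b + h₀ • n) σ u v m - reg a b n c σ u v m‖ :=
        norm_sub_le_norm_sub_add_norm_sub _ _ _
    _ ≤ τ₀ + τ := add_le_add (hloc m) (by rw [norm_reg_sub_reg hn.1, ← norm_neg, neg_sub]; exact hcc)
    _ ≤ r' := hτ

/-- ★ **SqR3 from geometry + height**: `SqRegistryGeometryW h₁ τ₀ → SqBalancedHeight h₁ τ → SqRegistryLocalisationW h₁ τ rₛ` for `τ₀ + τ ≤ rₛ`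
(the increment `holSq a b + h • n` at the balanced height is square-balanced by `isSqBalanced_of_normal`; re-centring costs `|h − h₁| ≤ τ`).
[this file] -/
theorem sqRegistryLocalisationW_of_geometry_height {Λ₁ t₁ t₂ h₁ τ₀ τ rₛ : ℝ} (hτ : τ₀ + τ ≤ rₛ)
    (hGeo : SqRegistryGeometryW Λ₁ t₁ t₂ h₁ τ₀) (hH : SqBalancedHeight t₁ t₂ h₁ τ) : SqRegistryLocalisationW Λ₁ t₁ t₂ h₁ τ rₛ := by
  intro δ hδ a b w hst hab ha hb hs hc hna hf hz hp
  obtain ⟨n, u, v, hn, hloc⟩ := hGeo δ hδ a b w hst hab ha hb hs hc hna hf hz hp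
  obtain ⟨h, hh, hhalf, hzn⟩ := hH a b n hp hn
  have hcn : ⟪holSq a b + h • n, n⟫ = h := inner_holSq_height hn h
  refine ⟨n, holSq a b + h • n, u, v, hn, isSqBalanced_of_normal hn (by rw [hcn]; exact hhalf) (lateral_holSq_height hn h) hzn,
    by rw [hcn]; exact hh, fun m => ?_⟩
  calc ‖incr w m - regSq a b (holSq a b + h • n) u v m‖
      ≤ ‖incr w m - regSq a b (holSq a b + h₁ • n) u v m‖ +
          ‖regSq a b (holSq a b + h₁ • n) u v m - regSq a b (holSq a b + h • n) u v m‖ := norm_sub_le_norm_sub_add_norm_sub _ _ _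
    _ ≤ τ₀ + τ := add_le_add (hloc m) (by rw [regSq_sub_regSq, norm_height_sub hn.1, abs_sub_comm]; exact hh)
    _ ≤ rₛ := hτ

/-- ★ **TWENTIETH seam (the repaired EIGHTEENTH).** `CellPinningDichotomyW → RegistryLocalisationW r′ → RegistryZeroExists r″ → RegistryMetric r″ →
SqRegistryLocalisationW h₁ τ rₛ → SqRegistryMetric h₁ τ rₛ″ → BasalReferenceW Λ₁ ρ₁` for `r″ < 1/2`, `r′ + r″ ≤ ρ₁`, `0 ≤ rₛ″`, `rₛ ≤ ρ₁`.
T branch: part XX's proof verbatim (the registry zero is the reference).  S branch: the square registry profile ITSELF is the reference — an offset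
profile with exactly these increments exists (`exists_profile_of_incr`), is stacked (heights `⟪c, n⟫ ≥ 1/2`), is within `rₛ` of the configuration,
has all gap stresses `= unifStress a b c = 0` (`gapStress_regSq`), and is uniformly clean by SqR5. [this file] -/
theorem basalReferenceW_of_dichotomy {Λ₁ s₁ s₂ t₁ t₂ r' r'' h₁ τ rₛ rₛ'' ρ₁ : ℝ} (hr'' : r'' < 1 / 2) (hρ₁ : r' + r'' ≤ ρ₁) (hrₛ'' : 0 ≤ rₛ'')
    (hrₛ : rₛ ≤ ρ₁) (hPin : CellPinningDichotomyW Λ₁ s₁ s₂ t₁ t₂) (hLoc : RegistryLocalisationW Λ₁ s₁ s₂ r')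
    (hEx : RegistryZeroExists s₁ s₂ r'') (hMet : RegistryMetric s₁ s₂ r'') (hSqLoc : SqRegistryLocalisationW Λ₁ t₁ t₂ h₁ τ rₛ)
    (hSqMet : SqRegistryMetric t₁ t₂ h₁ τ rₛ'') : BasalReferenceW Λ₁ ρ₁ := by
  intro δ hδ a b w hst hab ha hb hs hc hna hf hz
  rcases hPin δ hδ a b w hst hab ha hb hs hc hna hf hz with hp | hp
  · obtain ⟨n, c, σ, u, v, hn, hbal, hloc⟩ := hLoc δ hδ a b w hst hab ha hb hs hc hna hf hz hp
    obtain ⟨h, hh, hz'⟩ := hEx a b n c σ u v hp hn hbal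
    obtain ⟨w', hw'⟩ := exists_profile_of_incr h
    have hh' : ∀ k, ‖incr w' k - reg a b n c σ u v k‖ ≤ r'' := fun k => by rw [hw']; exact hh k
    refine ⟨w', isStacked_of_near_reg hn hbal.1 hh' hr'', fun m => ?_, fun m => by rw [hw']; exact hz' m,
      hMet a b n c σ u v hp hn hbal w' hh'⟩
    rw [tube, mem_closedBall, dist_eq_norm]
    calc ‖incr w' m - incr w m‖ ≤ ‖incr w' m - reg a b n c σ u v m‖ + ‖incr w m - reg a b n c σ u v m‖ := by
          rw [← norm_neg (incr w m - reg a b n c σ u v m), neg_sub]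
          exact norm_sub_le_norm_sub_add_norm_sub _ _ _
      _ ≤ r'' + r' := add_le_add (hh' m) (hloc m)
      _ ≤ ρ₁ := by linarith
  · obtain ⟨n, c, u, v, hn, hbal, hhgt, hloc⟩ := hSqLoc δ hδ a b w hst hab ha hb hs hc hna hf hz hp
    obtain ⟨w', hw'⟩ := exists_profile_of_incr (regSq a b c u v)
    have h0 : ∀ k, ‖incr w' k - regSq a b c u v k‖ ≤ 0 := fun k => by rw [hw', sub_self, norm_zero]
    refine ⟨w', isStacked_of_near_regSq hn hbal.1 h0 one_half_pos, fun m => ?_, fun m => by rw [hw', gapStress_regSq]; exact hbal.2.2,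
      hSqMet a b n c u v hp hn hbal.2.1 hhgt w' fun k => (h0 k).trans hrₛ''⟩
    rw [tube, mem_closedBall, dist_eq_norm, hw', ← norm_neg, neg_sub]
    exact (hloc m).trans hrₛ

/-! ## §5 The cones -/

/-- ★ **RDEF cone, TWENTIETH form** (every `Λ Λ₁ ρ₀ ρ₁ s₁ s₂ t₁ t₂ r′ r″ h₁ τ rₛ rₛ″` with `r″ < 1/2`, `r′ + r″ ≤ ρ₁`, `0 ≤ rₛ″`, `rₛ ≤ ρ₁`): the
XIX-U cone of record with slot 7d `BasalReferenceW Λ₁ ρ₁` := R4′ ∧ T{R3 `r′`, Z∃ `r″`, R5 `r″`} ∧ S{SqR3 `h₁ τ rₛ`, SqR5 `h₁ τ rₛ″`}. [this file] -/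
theorem rdef_of_grossU_shape_gluing_pinning_uniq_dichotomy (Λ Λ₁ ρ₀ ρ₁ s₁ s₂ t₁ t₂ r' r'' h₁ τ rₛ rₛ'' : ℝ) (hr'' : r'' < 1 / 2)
    (hρ₁ : r' + r'' ≤ ρ₁) (hrₛ'' : 0 ≤ rₛ'') (hrₛ : rₛ ≤ ρ₁)
    (hG : GrossCleanBallsU (1 / 250) 10) (hCEG : ChargedEnergyGap) (hC : CompressedVirialLaw (1 / 250) 10)
    (hS : TwoShellShape (1 / 100) (3 / 50) (1 / 450)) (hB₂ : BarlowGluingW) (hD : DoorPeriodicW Λ) (hSR : StackedReductionW Λ Λ₁)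
    (hV : GapStressVanishesW Λ₁) (hP : RegistryPinningW Λ₁ ρ₀ ρ₁) (hU : TubeUniquenessW Λ₁ ρ₀) (hPin : CellPinningDichotomyW Λ₁ s₁ s₂ t₁ t₂)
    (hLoc : RegistryLocalisationW Λ₁ s₁ s₂ r') (hEx : RegistryZeroExists s₁ s₂ r'') (hMet : RegistryMetric s₁ s₂ r'')
    (hSqLoc : SqRegistryLocalisationW Λ₁ t₁ t₂ h₁ τ rₛ) (hSqMet : SqRegistryMetric t₁ t₂ h₁ τ rₛ'')
    (hCE : CleanlessExcessT) (hRes : CoherentResidual 10) : RobustDefectLimitWindows :=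
  rdef_of_grossU_shape_gluing_pinning_uniqW Λ Λ₁ ρ₀ ρ₁ hG hCEG hC hS hB₂ hD hSR hV hP hU
    (basalReferenceW_of_dichotomy hr'' hρ₁ hrₛ'' hrₛ hPin hLoc hEx hMet hSqLoc hSqMet) hCE hRes

/-- ★ **RDEF cone, twentieth form, CONVEX-FED** (7c′ := lens-3's `TubeConvexW' Λ₁ ρ₀` via `tubeUniquenessW_of_tubeConvexW'`, the typing of the cone of
record `…_pinning_convexW'`; lens-3's split `TubeLipschitzW' ∧ TubeConvexityW'` feeds it through `tubeConvexW'_of_split`). [this file] -/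
theorem rdef_of_grossU_shape_gluing_pinning_convexW'_dichotomy (Λ Λ₁ ρ₀ ρ₁ s₁ s₂ t₁ t₂ r' r'' h₁ τ rₛ rₛ'' : ℝ) (hr'' : r'' < 1 / 2)
    (hρ₁ : r' + r'' ≤ ρ₁) (hrₛ'' : 0 ≤ rₛ'') (hrₛ : rₛ ≤ ρ₁)
    (hG : GrossCleanBallsU (1 / 250) 10) (hCEG : ChargedEnergyGap) (hC : CompressedVirialLaw (1 / 250) 10)
    (hS : TwoShellShape (1 / 100) (3 / 50) (1 / 450)) (hB₂ : BarlowGluingW) (hD : DoorPeriodicW Λ) (hSR : StackedReductionW Λ Λ₁)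
    (hV : GapStressVanishesW Λ₁) (hP : RegistryPinningW Λ₁ ρ₀ ρ₁) (hT : TubeConvexW' Λ₁ ρ₀) (hPin : CellPinningDichotomyW Λ₁ s₁ s₂ t₁ t₂)
    (hLoc : RegistryLocalisationW Λ₁ s₁ s₂ r') (hEx : RegistryZeroExists s₁ s₂ r'') (hMet : RegistryMetric s₁ s₂ r'')
    (hSqLoc : SqRegistryLocalisationW Λ₁ t₁ t₂ h₁ τ rₛ) (hSqMet : SqRegistryMetric t₁ t₂ h₁ τ rₛ'')
    (hCE : CleanlessExcessT) (hRes : CoherentResidual 10) : RobustDefectLimitWindows :=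
  rdef_of_grossU_shape_gluing_pinning_uniq_dichotomy Λ Λ₁ ρ₀ ρ₁ s₁ s₂ t₁ t₂ r' r'' h₁ τ rₛ rₛ'' hr'' hρ₁ hrₛ'' hrₛ hG hCEG hC hS hB₂ hD hSR hV hP
    (tubeUniquenessW_of_tubeConvexW' hT) hPin hLoc hEx hMet hSqLoc hSqMet hCE hRes

/-- ★ **the twentieth cone AT THE NUMBERS OF RECORD, LEAF-CUT** (`(Λ, Λ₁; ρ₀, ρ₁) = (2, 17/16; 1/40, 3/16)`; kernel currency `(ε, r, μ; r″) =
(1/250, 1/100, 1; 3/500)`; T `(τ₀, τ) = (3/20, 1/40)` so `r′ = 7/40`; S `(τ₀, τ, rₛ, rₛ″) = (3/20, 1/100, 4/25, 0)`; side conditions by `norm_num`;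
boxes `s₁ s₂ t₁ t₂` and central heights `h₀ h₁` SYMBOLIC until the census fixes them).  Leaves: slots 1–6, 7a, 7b, 7c″, 7c′ `TubeConvexW'` and, for
7d, R4T ∧ R4S ∧ R3geo ∧ `BalancedLocus` ∧ R1 ∧ R2 ∧ R5 ∧ SqR3geo ∧ `SqBalancedHeight` ∧ SqR5; slots 8, 9. [this file] -/
theorem rdef_twentieth_of_recordK (s₁ s₂ t₁ t₂ h₀ h₁ : ℝ) (hG : GrossCleanBallsU (1 / 250) 10) (hCEG : ChargedEnergyGap)
    (hC : CompressedVirialLaw (1 / 250) 10) (hS : TwoShellShape (1 / 100) (3 / 50) (1 / 450)) (hB₂ : BarlowGluingW) (hD : DoorPeriodicW 2)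
    (hSR : StackedReductionW 2 (17 / 16)) (hV : GapStressVanishesW (17 / 16)) (hP : RegistryPinningW (17 / 16) (1 / 40) (3 / 16))
    (hT : TubeConvexW' (17 / 16) (1 / 40)) (hPinT : CellPinningT (17 / 16) s₁ s₂) (hPinS : CellPinningS (17 / 16) t₁ t₂)
    (hGeo : RegistryGeometryW (17 / 16) s₁ s₂ h₀ (3 / 20)) (hBal : BalancedLocus s₁ s₂ h₀ (1 / 40)) (hR1 : RegistryResidual s₁ s₂ (1 / 250))
    (hR2 : RegistryTube s₁ s₂ (1 / 100) 1) (hMet : RegistryMetric s₁ s₂ (3 / 500)) (hSqGeo : SqRegistryGeometryW (17 / 16) t₁ t₂ h₁ (3 / 20))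
    (hSqH : SqBalancedHeight t₁ t₂ h₁ (1 / 100)) (hSqMet : SqRegistryMetric t₁ t₂ h₁ (1 / 100) 0) (hCE : CleanlessExcessT)
    (hRes : CoherentResidual 10) : RobustDefectLimitWindows :=
  rdef_of_grossU_shape_gluing_pinning_convexW'_dichotomy 2 (17 / 16) (1 / 40) (3 / 16) s₁ s₂ t₁ t₂ (7 / 40) (3 / 500) h₁ (1 / 100) (4 / 25) 0
    (by norm_num) (by norm_num) le_rfl (by norm_num) hG hCEG hC hS hB₂ hD hSR hV hP hT (cellPinningDichotomyW_of_TS le_rfl hPinT hPinS)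
    (registryLocalisationW_of_geometry_locus (by norm_num) hGeo hBal)
    (zeroExists_of_residual_tube (by norm_num) (by norm_num) (by norm_num) (by norm_num) (by norm_num) (by norm_num) hR1 hR2) hMet
    (sqRegistryLocalisationW_of_geometry_height (by norm_num) hSqGeo hSqH) hSqMet hCE hRes

end Summit.AtomisticToContinuum.Crystallization.Theorems.OverbindingBudgetRegistryDichotomy

end
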